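import Literature.ModelTheory.FiniteModelTheory.ESOArith
import Literature.ModelTheory.FiniteModelTheory.CodeLayout
import HarnessLib

/-!
# First-order numerals over guessed arithmetic and the input formula `ι` of Fagin's theorem

Topic `Literature/ModelTheory/FiniteModelTheory`; continues `ESOArith.lean` (Fagin's theorem,
hard direction; Libkin 2004, proof of Thm. 9.6, pp. 171–172). Two parts.

## Part 1 — numerals: constants, comparisons, bounded quantities, the bits of the size

Over tables `W` with STANDARD arithmetic (`IsStdArith W`: the order symbol is `<` on `Fin n`,
`PLUS/TIMES/EXP2` are the true graphs on `K`-tuple numbers `tval < n^K`) we provide DEFINABLE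
queries (in the sense of `ESODefinability.lean`) pinning down, as `K`-tuples of variables, the
numbers the tableau sentence needs, each with its correctness statement over standard tables:

* `LtN`, `LeN` — comparison of tuple numbers (`a < b ↔ ∃ c ≠ 0, a + c = b`);
* `NExpr` — numeric expressions `const c | univ | size | add | mul` in the universe size `n`
  (`univ ↦ n`, `size ↦ |bin n| = Nat.size n`), their values `NExpr.eval n`, the side condition
  `NExpr.Bdd e n K` (every sub-value is `< n^K`), and the definable query `IsVal e u`
  ("the tuple `u` codes `e.eval n`") with `isVal_iff` (correct whenever `Bdd`);
* `BitN i b` — "bit number `tval i` of the binary numeral of `n` is `b`"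
  (`Nat.testBit`, via `EXP2` and division with remainder), `bitN_iff`.

## Part 2 — the bits of the code of a finite structure are first-order over guessed arithmetic

Libkin 2004, proof of Thm. 9.6, p. 171: "Suppose we have formulae `ι(p⃗)` and `ξ(p⃗)` … such that
`𝔄 ⊨ ι(p⃗)` iff the `p⃗`th position of `enc(𝔄)` is `1` … and `𝔄 ⊨ ξ(p⃗)` iff `p⃗` exceeds the
length of `enc(𝔄)`"; p. 172: "in the presence of addition and multiplication … `ι` is
definable". Part 2 does this for the tree's code
`encodingSNPInstance ar ⟨n, R⟩ = boolPair (encodeNat n) (table bits)` (binary size header, then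
the separator `01`, then the `Σₛ n^{arₛ}` table bits laid out by `relTablesEquiv`):

* (the positions of the code — `codeOf R`, `getElem?_codeOf_header/sep0/sep1/table`, the layout
  lemma `relTablesEquiv_apply_table` — are in `CodeLayout.lean`);
* derived numeric expressions `NExpr.npow d` (`n^d`), `offE ar s` (`Σ_{i<s} n^{arᵢ}`), `tableBitsE`,
  `codeLenE` and their values;
* the query `InputBitP W R J b` — "position `tval J` of the code of `⟨n, R⟩` holds bit `b`" —
  its DEFINABILITY (`JQuery.isDef_inputBitP`) and its CORRECTNESS over standard arithmetic
  (`inputBitP_iff : InputBitP W R J b ↔ (codeOf R)[tval J]? = some b`).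

## References

* L. Libkin, *Elements of Finite Model Theory*, Springer 2004, proof of Thm. 9.6, pp. 171–173
  (the formulas `ι`, `ξ`; p. 172: "`ι` is definable … in the presence of addition and
  multiplication"); §6.1, (6.1) (layout of `enc(𝔄)`). Printed pages.
* N. Immerman, *Descriptive Complexity*, Springer 1999, §1.2 (`BIT`, `PLUS`, `TIMES`), §2.1
  (`bin(𝔄)`), Thm. 7.8.
-/


namespace Literature.ModelTheory.FiniteModelTheory

open Literature.Computability.Cryptography

section Numerals

variable {K : ℕ} {rest : List ℕ} {n : ℕ}

/-! ### Comparisons -/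

/-- `a < b` on tuple numbers: some nonzero `c` has `a + c = b`. [Immerman 1999, §1.2]
[folklore] -/
def LtN (W : RelTables (arithWit K rest) n) (a b : Fin K → Fin n) : Prop :=
  ∃ c : Fin K → Fin n, ¬ ZeroP W c ∧ PlusP W a c b

/-- `a ≤ b` on tuple numbers. [folklore] -/
def LeN (W : RelTables (arithWit K rest) n) (a b : Fin K → Fin n) : Prop :=
  LtN W a b ∨ a = b

variable {W : RelTables (arithWit K rest) n}

/-- Over standard arithmetic, `LtN a b ↔ tval a < tval b`. [folklore] -/
theorem ltN_iff (hW : IsStdArith W) (a b : Fin K → Fin n) : LtN W a b ↔ tval a < tval b := by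
  unfold LtN
  simp only [zeroP_iff hW.1, hW.2.1]
  constructor
  · rintro ⟨c, hc, h⟩; omega
  · intro h
    have hlt : tval b - tval a < n ^ K := by have := tval_lt b; omega
    exact ⟨tupOf _ hlt, by rw [tval_tupOf]; omega, by rw [tval_tupOf]; omega⟩

/-- Over standard arithmetic, `LeN a b ↔ tval a ≤ tval b`. [folklore] -/
theorem leN_iff (hW : IsStdArith W) (a b : Fin K → Fin n) : LeN W a b ↔ tval a ≤ tval b := by
  unfold LeN
  rw [ltN_iff hW]
  constructor
  · rintro (h | rfl)
    · exact h.le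
    · exact le_rfl
  · intro h
    rcases h.lt_or_eq with h | h
    · exact Or.inl h
    · exact Or.inr (tval_injective h)

/-! ### Numeric expressions in the universe size -/

/-- Numeric expressions in the universe size `n`: constants, `n` itself, the binary length
`|bin n|`, sums and products. [Libkin 2004, p. 172] [folklore] -/
inductive NExpr : Type
  | const (c : ℕ) : NExpr
  | univ : NExpr
  | size : NExpr
  | add (e₁ e₂ : NExpr) : NExpr
  | mul (e₁ e₂ : NExpr) : NExpr

namespace NExpr

/-- The value of a numeric expression at universe size `n`. [folklore] -/
def eval (n : ℕ) : NExpr → ℕ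
  | const c => c
  | univ => n
  | size => Nat.size n
  | add e₁ e₂ => e₁.eval n + e₂.eval n
  | mul e₁ e₂ => e₁.eval n * e₂.eval n

/-- BOUNDEDNESS: every sub-expression has value `< n^K` (so that it is coded by a `K`-tuple);
for `size` we also ask `2^{|bin n|} < n^K` (the power of two witnessing the length).
[folklore] -/
def Bdd (n K : ℕ) : NExpr → Prop
  | const c => c < n ^ K
  | univ => n < n ^ K
  | size => 2 ^ Nat.size n < n ^ K
  | add e₁ e₂ => e₁.Bdd n K ∧ e₂.Bdd n K ∧ e₁.eval n + e₂.eval n < n ^ K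
  | mul e₁ e₂ => e₁.Bdd n K ∧ e₂.Bdd n K ∧ e₁.eval n * e₂.eval n < n ^ K

/-- A bounded expression has value `< n^K`. [folklore] -/
theorem eval_lt_of_bdd {n K : ℕ} : ∀ {e : NExpr}, e.Bdd n K → e.eval n < n ^ K
  | const _, h => h
  | univ, h => h
  | size, h => lt_trans Nat.lt_two_pow_self h
  | add _ _, h => h.2.2
  | mul _ _, h => h.2.2

end NExpr

/-- The tuple `u` codes the CONSTANT `c`: a chain of `c` successors from zero.
[Immerman 1999, §1.2] [folklore] -/
def IsConstN (W : RelTables (arithWit K rest) n) : ℕ → (Fin K → Fin n) → Prop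
  | 0, u => ZeroP W u
  | c + 1, u => ∃ u', IsConstN W c u' ∧ SuccP W K u' u

/-- Over standard arithmetic, `IsConstN c u ↔ tval u = c`. [folklore] -/
theorem isConstN_iff (hW : IsStdArith W) : ∀ (c : ℕ) (u : Fin K → Fin n),
    IsConstN W c u ↔ tval u = c
  | 0, u => zeroP_iff hW.1 u
  | c + 1, u => by
    unfold IsConstN
    simp only [isConstN_iff hW c, succP_iff hW.1]
    constructor
    · rintro ⟨u', h', hs⟩; omega
    · intro h
      have hc : c < n ^ K := by have := tval_lt u; omega
      exact ⟨tupOf c hc, tval_tupOf c hc, by rw [tval_tupOf]; omega⟩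

/-- The tuple `u` codes the UNIVERSE SIZE `n`: it is the successor of `(max, 0, …, 0)`
(which codes `n - 1`). [Libkin 2004, p. 172] [folklore] -/
def IsUnivN (W : RelTables (arithWit K rest) n) (u : Fin K → Fin n) : Prop :=
  ∃ m : Fin K → Fin n, (∀ i : Fin K, 0 < (i : ℕ) → IsMinP W (m i)) ∧
    (∀ i : Fin K, (i : ℕ) = 0 → IsMaxP W (m i)) ∧ SuccP W K m u

/-- A tuple `(max, 0, …, 0)` codes `n - 1` (for `K ≥ 1`). [folklore] -/
theorem tval_eq_pred_of_digits (hK : 1 ≤ K) (m : Fin K → Fin n)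
    (h0 : ∀ i : Fin K, 0 < (i : ℕ) → (m i : ℕ) = 0)
    (hm : ∀ i : Fin K, (i : ℕ) = 0 → (m i : ℕ) = n - 1) :
    tval m = n - 1 := by
  obtain ⟨K', rfl⟩ : ∃ K', K = K' + 1 := ⟨K - 1, by omega⟩
  rw [tval_eq_head_add, hm 0 rfl, (tval_zero_iff (Fin.tail m)).2 fun j => h0 j.succ (by simp)]
  simp

/-- Over standard arithmetic (and `K ≥ 1`), `IsUnivN u ↔ tval u = n`. [folklore] -/
theorem isUnivN_iff (hW : IsStdArith W) (hK : 1 ≤ K) (u : Fin K → Fin n) :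
    IsUnivN W u ↔ tval u = n := by
  have hn : 0 < n := Nat.pos_of_ne_zero fun h => by subst h; exact (u ⟨0, hK⟩).elim0
  unfold IsUnivN
  simp only [isMinP_iff hW.1, isMaxP_iff hW.1, succP_iff hW.1]
  constructor
  · rintro ⟨m, h0, hm, hs⟩
    rw [hs, tval_eq_pred_of_digits hK m h0 hm]
    omega
  · intro h
    -- the tuple `(n - 1, 0, …, 0)`
    have hlt : n - 1 < n ^ K := by have := tval_lt u; omega
    refine ⟨tupOf (n - 1) hlt, fun (i : Fin K) hi => ?_, fun (i : Fin K) hi => ?_,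
      by rw [tval_tupOf]; omega⟩
    · -- digits of `n - 1 < n`: digit `i ≥ 1` is `(n-1) / n^i % n = 0`
      change ((finFunctionFinEquiv.symm ⟨n - 1, hlt⟩ : Fin K → Fin n) i : ℕ) = 0
      rw [finFunctionFinEquiv_symm_apply_val]
      change (n - 1) / n ^ (i : ℕ) % n = 0
      have : n - 1 < n ^ (i : ℕ) := by
        calc n - 1 < n := by omega
          _ = n ^ 1 := (pow_one n).symm
          _ ≤ n ^ (i : ℕ) := Nat.pow_le_pow_right hn hi
      rw [Nat.div_eq_of_lt this, Nat.zero_mod]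
    · change ((finFunctionFinEquiv.symm ⟨n - 1, hlt⟩ : Fin K → Fin n) i : ℕ) = n - 1
      rw [finFunctionFinEquiv_symm_apply_val]
      change (n - 1) / n ^ (i : ℕ) % n = n - 1
      rw [hi, pow_zero, Nat.div_one]
      exact Nat.mod_eq_of_lt (by omega)

/-- The tuple `u` codes the BINARY LENGTH `|bin n| = Nat.size n`: `n < 2^u` and
(`u = 0` or `2^(u-1) ≤ n`). [Libkin 2004, p. 172; Immerman 1999, §1.2] [folklore] -/
def IsSizeN (W : RelTables (arithWit K rest) n) (u : Fin K → Fin n) : Prop :=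
  ∃ N e : Fin K → Fin n, IsUnivN W N ∧ Exp2P W u e ∧ LtN W N e ∧
    (ZeroP W u ∨ ∃ u' e' : Fin K → Fin n, SuccP W K u' u ∧ Exp2P W u' e' ∧ LeN W e' N)

/-- The lower bound of the binary length: `2^(size n - 1) ≤ n` unless `size n = 0` (from Mathlib's
`Nat.size_le`; the tree's `BoolGadgets.size_eq_iff` packages the same characterisation).
[folklore] -/
theorem two_pow_size_pred_le (n : ℕ) : Nat.size n = 0 ∨ 2 ^ (Nat.size n - 1) ≤ n := by
  rcases Nat.eq_zero_or_pos (Nat.size n) with h | h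
  · exact Or.inl h
  · right
    by_contra hlt
    have := Nat.size_le.2 (not_le.1 hlt)
    omega

/-- Over standard arithmetic (with `K ≥ 1` and `2^{|bin n|} < n^K`), `IsSizeN u ↔ tval u = |bin n|`.
[folklore] -/
theorem isSizeN_iff (hW : IsStdArith W) (hK : 1 ≤ K) (hb : 2 ^ Nat.size n < n ^ K)
    (u : Fin K → Fin n) : IsSizeN W u ↔ tval u = Nat.size n := by
  unfold IsSizeN
  simp only [isUnivN_iff hW hK, hW.2.2.2, ltN_iff hW, leN_iff hW, zeroP_iff hW.1,
    succP_iff hW.1]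
  constructor
  · rintro ⟨N, e, hN, he, hlt, hz⟩
    rw [hN] at hlt
    apply le_antisymm
    · -- `tval u ≤ size n`
      rcases hz with hz | ⟨u', e', hs, he', hle⟩
      · rw [hz]; exact Nat.zero_le _
      · rw [hN] at hle
        have h1 : 2 ^ tval u' < 2 ^ Nat.size n := by rw [he']; exact lt_of_le_of_lt hle (Nat.lt_size_self n)
        have h2 := (Nat.pow_lt_pow_iff_right (by norm_num : 1 < 2)).1 h1
        omega
    · exact Nat.size_le.2 (by rw [he]; exact hlt)
  · intro h
    have hn : n < n ^ K := lt_of_lt_of_le (Nat.lt_size_self n) hb.le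
    have h2 : 2 ^ tval u < n ^ K := by rwa [h]
    refine ⟨tupOf n hn, tupOf _ h2, tval_tupOf n hn, (tval_tupOf _ h2).symm, ?_, ?_⟩
    · rw [tval_tupOf, tval_tupOf, h]; exact Nat.lt_size_self n
    · rcases Nat.eq_zero_or_pos (tval u) with hz | hz
      · exact Or.inl hz
      · right
        have hu' : tval u - 1 < n ^ K := by have := tval_lt u; omega
        have he' : 2 ^ (tval u - 1) < n ^ K := lt_of_le_of_lt (Nat.pow_le_pow_right (by norm_num)
          (Nat.sub_le _ _)) h2
        refine ⟨tupOf _ hu', tupOf _ he', by rw [tval_tupOf]; omega, by rw [tval_tupOf, tval_tupOf],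
          ?_⟩
        rw [tval_tupOf, tval_tupOf]
        rcases two_pow_size_pred_le n with hz' | hle
        · omega
        · rw [h]; exact hle

/-- `IsVal e u`: the tuple `u` codes the value of the numeric expression `e`.
[Libkin 2004, p. 172] [folklore] -/
def IsVal (W : RelTables (arithWit K rest) n) : NExpr → (Fin K → Fin n) → Prop
  | NExpr.const c, u => IsConstN W c u
  | NExpr.univ, u => IsUnivN W u
  | NExpr.size, u => IsSizeN W u
  | NExpr.add e₁ e₂, u => ∃ u₁ u₂, IsVal W e₁ u₁ ∧ IsVal W e₂ u₂ ∧ PlusP W u₁ u₂ u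
  | NExpr.mul e₁ e₂, u => ∃ u₁ u₂, IsVal W e₁ u₁ ∧ IsVal W e₂ u₂ ∧ TimesP W u₁ u₂ u

/-- **Correctness of numerals**: over standard arithmetic (`K ≥ 1`), for a BOUNDED expression,
`IsVal e u ↔ tval u = e.eval n`. [Libkin 2004, p. 172] [folklore] -/
theorem isVal_iff (hW : IsStdArith W) (hK : 1 ≤ K) : ∀ {e : NExpr}, e.Bdd n K →
    ∀ u : Fin K → Fin n, IsVal W e u ↔ tval u = e.eval n
  | NExpr.const c, _, u => isConstN_iff hW c u
  | NExpr.univ, _, u => isUnivN_iff hW hK u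
  | NExpr.size, hb, u => isSizeN_iff hW hK hb u
  | NExpr.add e₁ e₂, hb, u => by
    unfold IsVal
    simp only [isVal_iff hW hK hb.1, isVal_iff hW hK hb.2.1, hW.2.1, NExpr.eval]
    constructor
    · rintro ⟨u₁, u₂, h₁, h₂, h⟩; omega
    · intro h
      exact ⟨tupOf _ (NExpr.eval_lt_of_bdd hb.1), tupOf _ (NExpr.eval_lt_of_bdd hb.2.1),
        tval_tupOf _ _, tval_tupOf _ _, by rw [tval_tupOf, tval_tupOf, h]⟩
  | NExpr.mul e₁ e₂, hb, u => by
    unfold IsVal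
    simp only [isVal_iff hW hK hb.1, isVal_iff hW hK hb.2.1, hW.2.2.1, NExpr.eval]
    constructor
    · rintro ⟨u₁, u₂, h₁, h₂, h⟩; rw [← h, h₁, h₂]
    · intro h
      exact ⟨tupOf _ (NExpr.eval_lt_of_bdd hb.1), tupOf _ (NExpr.eval_lt_of_bdd hb.2.1),
        tval_tupOf _ _, tval_tupOf _ _, by rw [tval_tupOf, tval_tupOf, h]⟩

/-! ### Bits of the universe size -/

/-- `BitN i b`: bit number `tval i` of the binary numeral of `n` is `b`, i.e.
`n.testBit (tval i) = b`: with `e = 2^i`, `n = q · 2e + r`, `r < 2e`, the bit is `[e ≤ r]`.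
[Immerman 1999, §1.2 (`BIT`)] [folklore] -/
def BitN (W : RelTables (arithWit K rest) n) (i : Fin K → Fin n) (b : Bool) : Prop :=
  ∃ N e e2 q qe r : Fin K → Fin n, IsUnivN W N ∧ Exp2P W i e ∧ PlusP W e e e2 ∧
    TimesP W q e2 qe ∧ PlusP W qe r N ∧ LtN W r e2 ∧ (LeN W e r ↔ b = true)

/-- `testBit` via division with remainder by `2^(i+1)`. [folklore] -/
theorem testBit_iff_mod (n i : ℕ) : n.testBit i = true ↔ 2 ^ i ≤ n % 2 ^ (i + 1) := by
  rw [Nat.testBit_eq_decide_div_mod_eq, decide_eq_true_eq, Nat.mod_pow_succ]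
  have h1 : n / 2 ^ i % 2 < 2 := Nat.mod_lt _ (by norm_num)
  have h2 : n % 2 ^ i < 2 ^ i := Nat.mod_lt _ (Nat.two_pow_pos _)
  have hp : 0 < 2 ^ i := Nat.two_pow_pos _
  constructor
  · intro h; rw [h, Nat.mul_one]; omega
  · intro h
    by_contra hne
    have h0 : n / 2 ^ i % 2 = 0 := by omega
    rw [h0, Nat.mul_zero, Nat.add_zero] at h
    omega

/-- Over standard arithmetic (`K ≥ 1`, `n < n^K` and `2^(tval i + 1) < n^K`),
`BitN i b ↔ n.testBit (tval i) = b`. [Immerman 1999, §1.2] [folklore] -/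
theorem bitN_iff (hW : IsStdArith W) (hK : 1 ≤ K) (hn : n < n ^ K) (i : Fin K → Fin n)
    (hi : 2 ^ (tval i + 1) < n ^ K) (b : Bool) : BitN W i b ↔ n.testBit (tval i) = b := by
  unfold BitN
  simp only [isUnivN_iff hW hK, hW.2.2.2, hW.2.1, hW.2.2.1, ltN_iff hW, leN_iff hW]
  have key : ∀ r : ℕ, r = n % 2 ^ (tval i + 1) →
      ((2 ^ tval i ≤ r ↔ b = true) ↔ n.testBit (tval i) = b) := by
    rintro r rfl
    rw [← testBit_iff_mod, ← Bool.eq_iff_iff]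
  constructor
  · rintro ⟨N, e, e2, q, qe, r, hN, he, he2, hqe, hr, hlt, hb⟩
    have h2 : tval e2 = 2 ^ (tval i + 1) := by rw [← he2, ← he, pow_succ]; ring
    have hr' : tval r = n % 2 ^ (tval i + 1) := by
      rw [← h2]
      calc tval r = (tval q * tval e2 + tval r) % tval e2 := by
            rw [Nat.mul_add_mod', Nat.mod_eq_of_lt hlt]
        _ = n % tval e2 := by rw [hqe, hr, hN]
    have hb' : (2 ^ tval i ≤ tval r ↔ b = true) := by rw [he]; exact hb
    exact (key (tval r) hr').1 hb'
  · intro h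
    have hpos : 0 < 2 ^ (tval i + 1) := Nat.two_pow_pos _
    have he : 2 ^ tval i < n ^ K :=
      lt_of_le_of_lt (Nat.pow_le_pow_right (by norm_num) (Nat.le_succ _)) hi
    have hq : n / 2 ^ (tval i + 1) * 2 ^ (tval i + 1) < n ^ K :=
      lt_of_le_of_lt (Nat.div_mul_le_self _ _) hn
    have hq' : n / 2 ^ (tval i + 1) < n ^ K := lt_of_le_of_lt (Nat.div_le_self _ _) hn
    have hr : n % 2 ^ (tval i + 1) < n ^ K := lt_of_le_of_lt (Nat.mod_le _ _) hn
    refine ⟨tupOf n hn, tupOf _ he, tupOf _ hi, tupOf _ hq', tupOf _ hq, tupOf _ hr,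
      tval_tupOf n hn, by rw [tval_tupOf], by rw [tval_tupOf, tval_tupOf, pow_succ]; ring,
      by rw [tval_tupOf, tval_tupOf, tval_tupOf], ?_, ?_, ?_⟩
    · rw [tval_tupOf, tval_tupOf, tval_tupOf]; exact Nat.div_add_mod' n _
    · rw [tval_tupOf, tval_tupOf]; exact Nat.mod_lt _ hpos
    · rw [tval_tupOf, tval_tupOf]; exact (key _ rfl).2 h

end Numerals

/-! ### Definability of the numerals -/

namespace JQuery

variable {ar rest : List ℕ} {K : ℕ} {α : Type}

/-- `LtN` on variable tuples is definable. [folklore] -/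
theorem isDef_ltN (a b : Fin K → α) :
    IsDef (fun _ (_ : RelTables ar _) (W : RelTables (arithWit K rest) _) (v : α → _) =>
      LtN W (v ∘ a) (v ∘ b)) :=
  (((isDef_zeroP (ar := ar) (K := K) (rest := rest) (α := α ⊕ Fin K) Sum.inr).not.and
    (isDef_plusP (Sum.inl ∘ a) Sum.inr (Sum.inl ∘ b))).exs).of_iff fun _ _ _ _ => Iff.rfl

/-- `LeN` on variable tuples is definable. [folklore] -/
theorem isDef_leN (a b : Fin K → α) :
    IsDef (fun _ (_ : RelTables ar _) (W : RelTables (arithWit K rest) _) (v : α → _) =>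
      LeN W (v ∘ a) (v ∘ b)) :=
  (isDef_ltN a b).or (isDef_tupEq a b)

/-- `IsConstN c` on a variable tuple is definable (induction on `c`). [folklore] -/
theorem isDef_isConstN : ∀ (c : ℕ) {α : Type} (a : Fin K → α),
    IsDef (fun _ (_ : RelTables ar _) (W : RelTables (arithWit K rest) _) (v : α → _) =>
      IsConstN W c (v ∘ a))
  | 0, _, a => (isDef_zeroP a).of_iff fun _ _ _ _ => Iff.rfl
  | c + 1, α, a =>
    (((isDef_isConstN c (α := α ⊕ Fin K) Sum.inr).and
      (isDef_succP K Sum.inr (Sum.inl ∘ a))).exs).of_iff fun _ _ _ _ => Iff.rfl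

/-- `IsUnivN` on a variable tuple is definable. [folklore] -/
theorem isDef_isUnivN (a : Fin K → α) :
    IsDef (fun _ (_ : RelTables ar _) (W : RelTables (arithWit K rest) _) (v : α → _) =>
      IsUnivN W (v ∘ a)) := by
  have h1 : IsDef (fun _ (_ : RelTables ar _) (W : RelTables (arithWit K rest) _)
      (v : α ⊕ Fin K → _) => ∀ i : Fin K, 0 < (i : ℕ) → IsMinP W (v (Sum.inr i))) :=
    IsDef.iInf fun i : Fin K => (isDef_const (0 < (i : ℕ))).imp (isDef_isMinP (Sum.inr i))
  have h2 : IsDef (fun _ (_ : RelTables ar _) (W : RelTables (arithWit K rest) _)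
      (v : α ⊕ Fin K → _) => ∀ i : Fin K, (i : ℕ) = 0 → IsMaxP W (v (Sum.inr i))) :=
    IsDef.iInf fun i : Fin K => (isDef_const ((i : ℕ) = 0)).imp (isDef_isMaxP (Sum.inr i))
  have h3 := isDef_succP (ar := ar) (K := K) (rest := rest) (α := α ⊕ Fin K) K Sum.inr
    (Sum.inl ∘ a)
  exact ((h1.and (h2.and h3)).exs).of_iff fun _ _ _ _ => Iff.rfl

/-- `IsSizeN` on a variable tuple is definable. [folklore] -/
theorem isDef_isSizeN (a : Fin K → α) :
    IsDef (fun _ (_ : RelTables ar _) (W : RelTables (arithWit K rest) _) (v : α → _) =>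
      IsSizeN W (v ∘ a)) := by
  -- outer block: `N = inl inr`, `e = inr` over `α`; inner block: `u' = inl inr`, `e' = inr`
  let V2 : Type := (α ⊕ Fin K) ⊕ Fin K
  let aV : Fin K → V2 := fun i => Sum.inl (Sum.inl (a i))
  let NV : Fin K → V2 := fun i => Sum.inl (Sum.inr i)
  let eV : Fin K → V2 := fun i => Sum.inr i
  have hs := isDef_succP (ar := ar) (K := K) (rest := rest) (α := (V2 ⊕ Fin K) ⊕ Fin K) K
    (Sum.inl ∘ Sum.inr) (Sum.inl ∘ Sum.inl ∘ aV)
  have he := isDef_exp2P (ar := ar) (K := K) (rest := rest) (α := (V2 ⊕ Fin K) ⊕ Fin K)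
    (Sum.inl ∘ Sum.inr) Sum.inr
  have hl := isDef_leN (ar := ar) (K := K) (rest := rest) (α := (V2 ⊕ Fin K) ⊕ Fin K)
    Sum.inr (Sum.inl ∘ Sum.inl ∘ NV)
  have hin : IsDef (fun _ (_ : RelTables ar _) (W : RelTables (arithWit K rest) _)
      (v : V2 → _) => ∃ u' e' : Fin K → _, SuccP W K u' (v ∘ aV) ∧ Exp2P W u' e' ∧
        LeN W e' (v ∘ NV)) :=
    ((hs.and (he.and hl)).exs.exs).of_iff fun _ _ _ _ => Iff.rfl
  have hN := isDef_isUnivN (ar := ar) (K := K) (rest := rest) NV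
  have he2 := isDef_exp2P (ar := ar) (K := K) (rest := rest) aV eV
  have hlt := isDef_ltN (ar := ar) (K := K) (rest := rest) NV eV
  have hz := isDef_zeroP (ar := ar) (K := K) (rest := rest) aV
  exact ((hN.and (he2.and (hlt.and (hz.or hin)))).exs.exs).of_iff fun _ _ _ _ => Iff.rfl

/-- **Numerals are first-order**: `IsVal e` on a variable tuple is definable (induction on
`e`). [Libkin 2004, p. 172] [folklore] -/
theorem isDef_isVal : ∀ (e : NExpr) {α : Type} (a : Fin K → α),
    IsDef (fun _ (_ : RelTables ar _) (W : RelTables (arithWit K rest) _) (v : α → _) =>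
      IsVal W e (v ∘ a))
  | NExpr.const c, _, a => (isDef_isConstN c a).of_iff fun _ _ _ _ => Iff.rfl
  | NExpr.univ, _, a => (isDef_isUnivN a).of_iff fun _ _ _ _ => Iff.rfl
  | NExpr.size, _, a => (isDef_isSizeN a).of_iff fun _ _ _ _ => Iff.rfl
  | NExpr.add e₁ e₂, α, a => by
    have h1 := isDef_isVal e₁ (α := (α ⊕ Fin K) ⊕ Fin K) (Sum.inl ∘ Sum.inr)
    have h2 := isDef_isVal e₂ (α := (α ⊕ Fin K) ⊕ Fin K) Sum.inr
    have h3 := isDef_plusP (ar := ar) (K := K) (rest := rest) (α := (α ⊕ Fin K) ⊕ Fin K)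
      (Sum.inl ∘ Sum.inr) Sum.inr (Sum.inl ∘ Sum.inl ∘ a)
    exact ((h1.and (h2.and h3)).exs.exs).of_iff fun _ _ _ _ => Iff.rfl
  | NExpr.mul e₁ e₂, α, a => by
    have h1 := isDef_isVal e₁ (α := (α ⊕ Fin K) ⊕ Fin K) (Sum.inl ∘ Sum.inr)
    have h2 := isDef_isVal e₂ (α := (α ⊕ Fin K) ⊕ Fin K) Sum.inr
    have h3 := isDef_timesP (ar := ar) (K := K) (rest := rest) (α := (α ⊕ Fin K) ⊕ Fin K)
      (Sum.inl ∘ Sum.inr) Sum.inr (Sum.inl ∘ Sum.inl ∘ a)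
    exact ((h1.and (h2.and h3)).exs.exs).of_iff fun _ _ _ _ => Iff.rfl

/-- **`BIT` is first-order over guessed arithmetic**: `BitN i b` is definable.
[Immerman 1999, §1.2] [folklore] -/
theorem isDef_bitN (a : Fin K → α) (b : Bool) :
    IsDef (fun _ (_ : RelTables ar _) (W : RelTables (arithWit K rest) _) (v : α → _) =>
      BitN W (v ∘ a) b) := by
  -- one block of six tuples: `N e e2 q qe r ↦ 0 … 5`
  let V : Type := α ⊕ (Fin 6 × Fin K)
  let t : Fin 6 → Fin K → V := fun j i => Sum.inr (j, i)
  have h : IsDef (fun _ (_ : RelTables ar _) (W : RelTables (arithWit K rest) _) (v : V → _) =>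
      IsUnivN W (v ∘ t 0) ∧ Exp2P W (v ∘ Sum.inl ∘ a) (v ∘ t 1) ∧
        PlusP W (v ∘ t 1) (v ∘ t 1) (v ∘ t 2) ∧ TimesP W (v ∘ t 3) (v ∘ t 2) (v ∘ t 4) ∧
        PlusP W (v ∘ t 4) (v ∘ t 5) (v ∘ t 0) ∧ LtN W (v ∘ t 5) (v ∘ t 2) ∧
        (LeN W (v ∘ t 1) (v ∘ t 5) ↔ b = true)) :=
    (isDef_isUnivN (t 0)).and ((isDef_exp2P (Sum.inl ∘ a) (t 1)).and ((isDef_plusP (t 1) (t 1)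
      (t 2)).and ((isDef_timesP (t 3) (t 2) (t 4)).and ((isDef_plusP (t 4) (t 5) (t 0)).and
      ((isDef_ltN (t 5) (t 2)).and ((isDef_leN (t 1) (t 5)).iff (isDef_const (b = true))))))))
  refine h.exs.of_iff fun _ _ W v => ?_
  constructor
  · rintro ⟨w, hw⟩
    exact ⟨_, _, _, _, _, _, hw⟩
  · rintro ⟨N, e, e2, q, qe, r, hw⟩
    exact ⟨fun p => (![N, e, e2, q, qe, r] : Fin 6 → Fin K → _) p.1 p.2, hw⟩

end JQuery

/-! ## Part 2: the input formula `ι` -/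

open _root_.Computability Literature.Computability.Complexity Literature.Computability.Cryptography

/-! ### Derived numeric expressions: powers, offsets, the code length -/

namespace NExpr

/-- `n^d` as a numeric expression. [folklore] -/
def npow : ℕ → NExpr
  | 0 => const 1
  | d + 1 => mul (npow d) univ

/-- `(npow d).eval n = n^d`. [folklore] -/
@[simp] theorem eval_npow (n : ℕ) : ∀ d : ℕ, (npow d).eval n = n ^ d
  | 0 => rfl
  | d + 1 => by rw [npow, eval, eval_npow n d, eval, pow_succ]

/-- The offset `Σ_{i<s} n^{arᵢ}` of table `s` as a numeric expression. [Libkin 2004, (6.1)]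
[folklore] -/
def offE (ar : List ℕ) : ℕ → NExpr
  | 0 => const 0
  | s + 1 => add (offE ar s) (npow (ar.getD s 0))

/-- `(offE ar s).eval n = Σ_{i<s} n^{arᵢ}`. [folklore] -/
theorem eval_offE (ar : List ℕ) (n : ℕ) : ∀ s : ℕ,
    (offE ar s).eval n = ∑ i ∈ Finset.range s, n ^ ar.getD i 0
  | 0 => by simp [offE, eval]
  | s + 1 => by rw [offE, eval, eval_offE ar n s, eval_npow, Finset.sum_range_succ]

/-- The number of table bits as a numeric expression. [folklore] -/
def tableBitsE (ar : List ℕ) : NExpr := offE ar ar.length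

/-- The code length `2|bin n| + 2 + tableBits ar n` as a numeric expression.
[Libkin 2004, (6.2)] [folklore] -/
def codeLenE (ar : List ℕ) : NExpr := add (add (add size size) (const 2)) (tableBitsE ar)

/-- The largest quantity that the boundedness side condition of `e` requires to be `< n^K`.
[folklore] -/
def req (n : ℕ) : NExpr → ℕ
  | const c => c
  | univ => n
  | size => 2 ^ Nat.size n
  | add e₁ e₂ => max (max (e₁.req n) (e₂.req n)) (e₁.eval n + e₂.eval n)
  | mul e₁ e₂ => max (max (e₁.req n) (e₂.req n)) (e₁.eval n * e₂.eval n)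

/-- `Bdd` from a bound on `req`. [folklore] -/
theorem bdd_of_req_lt {n K : ℕ} : ∀ {e : NExpr}, e.req n < n ^ K → e.Bdd n K
  | const _, h => h
  | univ, h => h
  | size, h => h
  | add _ _, h => by
    simp only [req, max_lt_iff] at h
    exact ⟨bdd_of_req_lt h.1.1, bdd_of_req_lt h.1.2, h.2⟩
  | mul _ _, h => by
    simp only [req, max_lt_iff] at h
    exact ⟨bdd_of_req_lt h.1.1, bdd_of_req_lt h.1.2, h.2⟩

/-- The value is at most `req`. [folklore] -/
theorem eval_le_req (n : ℕ) : ∀ e : NExpr, e.eval n ≤ e.req n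
  | const _ => le_rfl
  | univ => le_rfl
  | size => show Nat.size n ≤ 2 ^ Nat.size n from Nat.lt_two_pow_self.le
  | add _ _ => le_max_right _ _
  | mul _ _ => le_max_right _ _

end NExpr

/-- `tableOffset` as a sum over `Finset.range`. [folklore] -/
theorem tableOffset_eq {ar : List ℕ} (n : ℕ) (s : Fin ar.length) :
    tableOffset ar n s = ∑ i ∈ Finset.range s, n ^ ar.getD i 0 := by
  unfold tableOffset
  rw [← Fin.sum_univ_eq_sum_range (fun i => n ^ ar.getD i 0) s]
  refine Finset.sum_congr rfl fun i _ => ?_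
  congr 1
  rw [List.getD_eq_getElem _ _ (by have := i.2; have := s.2; omega)]
  rfl

/-- `tableBits` as a sum over `Finset.range`. [folklore] -/
theorem tableBits_eq_sum_range (ar : List ℕ) (n : ℕ) :
    tableBits ar n = ∑ i ∈ Finset.range ar.length, n ^ ar.getD i 0 := by
  unfold tableBits
  rw [← Fin.sum_univ_eq_sum_range (fun i => n ^ ar.getD i 0)]
  refine Finset.sum_congr rfl fun i _ => ?_
  congr 1
  rw [List.getD_eq_getElem _ _ i.2]
  rfl

/-- `(offE ar s).eval n = tableOffset ar n s`. [folklore] -/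
theorem eval_offE_eq_tableOffset {ar : List ℕ} (n : ℕ) (s : Fin ar.length) :
    (NExpr.offE ar s).eval n = tableOffset ar n s := by
  rw [NExpr.eval_offE, tableOffset_eq]

/-- `(tableBitsE ar).eval n = tableBits ar n`. [folklore] -/
@[simp] theorem eval_tableBitsE (ar : List ℕ) (n : ℕ) :
    (NExpr.tableBitsE ar).eval n = tableBits ar n := by
  rw [NExpr.tableBitsE, NExpr.eval_offE, tableBits_eq_sum_range]

/-- `(codeLenE ar).eval n = |codeOf R|` for every `R`. [Libkin 2004, (6.2)] [folklore] -/
theorem eval_codeLenE {ar : List ℕ} {n : ℕ} (R : RelTables ar n) :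
    (NExpr.codeLenE ar).eval n = (codeOf R).length := by
  rw [length_codeOf, NExpr.codeLenE]
  simp only [NExpr.eval, eval_tableBitsE]
  ring

/-! ### Bounds for the derived expressions -/

namespace NExpr

/-- `req (npow d) ≤ max n (n^d)` for `n ≥ 1`. [folklore] -/
theorem req_npow_le {n : ℕ} (hn : 1 ≤ n) : ∀ d : ℕ, (npow d).req n ≤ max n (n ^ d)
  | 0 => by simp only [npow, req, pow_zero]; exact le_max_of_le_left hn
  | d + 1 => by
    simp only [npow, req, eval_npow, eval, max_le_iff]
    refine ⟨⟨(req_npow_le hn d).trans (max_le (le_max_left _ _) ?_), le_max_left _ _⟩, ?_⟩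
    · exact le_max_of_le_right (Nat.pow_le_pow_right hn (Nat.le_succ d))
    · rw [← pow_succ]; exact le_max_right _ _

/-- `req (offE ar s) ≤ max n (Σ_{i<s} n^{arᵢ})` for `n ≥ 1`. [folklore] -/
theorem req_offE_le (ar : List ℕ) {n : ℕ} (hn : 1 ≤ n) : ∀ s : ℕ,
    (offE ar s).req n ≤ max n (∑ i ∈ Finset.range s, n ^ ar.getD i 0)
  | 0 => by simp [offE, req]
  | s + 1 => by
    simp only [offE, req, eval_offE, eval_npow, Finset.sum_range_succ, max_le_iff]
    refine ⟨⟨(req_offE_le ar hn s).trans (max_le (le_max_left _ _)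
      (le_max_of_le_right (Nat.le_add_right _ _))), (req_npow_le hn _).trans
        (max_le (le_max_left _ _) (le_max_of_le_right (Nat.le_add_left _ _)))⟩, le_max_right _ _⟩

end NExpr

/-! ### The input-bit query `ι` -/

section Iota

variable {K : ℕ} {rest : List ℕ} {n : ℕ} {ar : List ℕ}

/-- Padding a short digit tuple with zero digits up to length `K`. [folklore] -/
def padT (hn : 0 < n) {a : ℕ} (w : Fin a → Fin n) : Fin K → Fin n :=
  fun i => if hi : (i : ℕ) < a then w ⟨i, hi⟩ else ⟨0, hn⟩

/-- The low digits of the padding are the given ones. [folklore] -/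
theorem padT_comp_castLE (hn : 0 < n) {a : ℕ} (ha : a ≤ K) (w : Fin a → Fin n) :
    (padT (K := K) hn w) ∘ Fin.castLE ha = w := by
  funext i
  simp [padT, i.2]

/-- The high digits of the padding are zero. [folklore] -/
theorem padT_high (hn : 0 < n) {a : ℕ} (w : Fin a → Fin n) (i : Fin K) (hi : a ≤ (i : ℕ)) :
    ((padT (K := K) hn w) i : ℕ) = 0 := by
  simp [padT, not_lt.2 hi]

/-- **A tuple with zero high digits codes the number of its low digits.** [folklore] -/
theorem tval_eq_of_high_zero {a : ℕ} (ha : a ≤ K) (u : Fin K → Fin n)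
    (h : ∀ i : Fin K, a ≤ (i : ℕ) → (u i : ℕ) = 0) :
    tval u = (finFunctionFinEquiv (u ∘ Fin.castLE ha) : ℕ) := by
  rw [tval_eq_sum, finFunctionFinEquiv_apply]
  let f : ℕ → ℕ := fun i => (if hi : i < K then (u ⟨i, hi⟩ : ℕ) else 0) * n ^ i
  have hK : ∑ i : Fin K, (u i : ℕ) * n ^ (i : ℕ) = ∑ i ∈ Finset.range K, f i := by
    rw [← Fin.sum_univ_eq_sum_range]
    exact Finset.sum_congr rfl fun i _ => by simp [f, i.2]
  have ha' : ∑ i : Fin a, ((u ∘ Fin.castLE ha) i : ℕ) * n ^ (i : ℕ) =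
      ∑ i ∈ Finset.range a, f i := by
    rw [← Fin.sum_univ_eq_sum_range]
    exact Finset.sum_congr rfl fun i _ => by
      have : (i : ℕ) < K := lt_of_lt_of_le i.2 ha
      simp only [f, Function.comp_apply, dif_pos this]
      rfl
  rw [hK, ha', Finset.range_eq_Ico, Finset.range_eq_Ico,
    ← Finset.sum_Ico_consecutive f (Nat.zero_le a) ha]
  suffices ∑ i ∈ Finset.Ico a K, f i = 0 by rw [this, Nat.add_zero]
  refine Finset.sum_eq_zero fun i hi => ?_
  rw [Finset.mem_Ico] at hi
  simp [f, hi.2, h ⟨i, hi.2⟩ hi.1]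

/-- The INPUT-BIT QUERY `ι(J⃗, b)`: position `tval J` of the code
`boolPair (encodeNat n) (table bits)` of `⟨n, R⟩` holds bit `b`. Four cases by position: a
(doubled) binary digit of `n` (`BitN`), the separator `0`, the separator `1`, or a table bit —
table `s`, tuple `w` (a block of `K` digit variables whose digits beyond the arity of `s` are
zero), position `2|bin n| + 2 + offset(s) + Σ wᵢ nⁱ`, bit `Rₛ(w)`.
[Libkin 2004, proof of Thm. 9.6, pp. 171–173 (`ι`); Immerman 1999, Thm. 7.8] [folklore] -/
def InputBitP (W : RelTables (arithWit K rest) n) (R : RelTables ar n)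
    (hK : ∀ s : Fin ar.length, ar.get s ≤ K) (J : Fin K → Fin n) (b : Bool) : Prop :=
  ∃ L L2 : Fin K → Fin n, IsVal W NExpr.size L ∧ PlusP W L L L2 ∧
    ((∃ i i2 : Fin K → Fin n, PlusP W i i i2 ∧ (J = i2 ∨ SuccP W K i2 J) ∧ LtN W J L2 ∧
        BitN W i b) ∨
      (J = L2 ∧ b = false) ∨
      (SuccP W K L2 J ∧ b = true) ∨
      ∃ s : Fin ar.length, ∃ two L22 O base w : Fin K → Fin n,
        IsConstN W 2 two ∧ PlusP W L2 two L22 ∧ IsVal W (NExpr.offE ar s) O ∧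
          PlusP W L22 O base ∧ (∀ i : Fin K, ar.get s ≤ (i : ℕ) → IsMinP W (w i)) ∧
          PlusP W base w J ∧ R s (w ∘ Fin.castLE (hK s)) = b)

variable {W : RelTables (arithWit K rest) n} {R : RelTables ar n}
  {hK : ∀ s : Fin ar.length, ar.get s ≤ K}

/-- **Correctness of `ι`** over standard arithmetic: provided the code length, `n` and
`2^{|bin n|}` are below `n^K` (all positions are tuple numbers), `InputBitP W R J b` holds iff
position `tval J` of the code of `⟨n, R⟩` is the bit `b`.
[Libkin 2004, proof of Thm. 9.6, pp. 171–173] [folklore] -/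
theorem inputBitP_iff (hW : IsStdArith W) (hK1 : 1 ≤ K) (hsz : 2 ^ Nat.size n < n ^ K)
    (hn : n < n ^ K) (hlen : (codeOf R).length < n ^ K) (J : Fin K → Fin n) (b : Bool) :
    InputBitP W R hK J b ↔ (codeOf R)[tval J]? = some b := by
  have hnpos : 0 < n := by
    rcases Nat.eq_zero_or_pos n with rfl | h
    · rw [zero_pow (by omega)] at hn; exact absurd hn (lt_irrefl 0)
    · exact h
  have hn1 : 1 ≤ n := hnpos
  rw [length_codeOf] at hlen
  have hℓK : Nat.size n < n ^ K := lt_trans Nat.lt_two_pow_self hsz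
  have hbsz : NExpr.Bdd n K NExpr.size := hsz
  have hoff : ∀ s : Fin ar.length, (NExpr.offE ar s).Bdd n K := fun s => by
    refine NExpr.bdd_of_req_lt ((NExpr.req_offE_le ar hn1 s).trans_lt (max_lt hn ?_))
    rw [← tableOffset_eq]
    have : tableOffset ar n s ≤ tableBits ar n := by
      have h : ((finSigmaFinEquiv (⟨s, finFunctionFinEquiv fun _ => ⟨0, hnpos⟩⟩ :
        Σ i : Fin ar.length, Fin (n ^ ar.get i)) : Fin (tableBits ar n)) : ℕ) < tableBits ar n :=
        Fin.is_lt _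
      rw [val_finSigmaFinEquiv_table] at h
      omega
    omega
  unfold InputBitP
  simp only [isVal_iff hW hK1 hbsz, hW.2.1, succP_iff hW.1, ltN_iff hW, isConstN_iff hW,
    NExpr.eval, isMinP_iff hW.1]
  constructor
  · rintro ⟨L, L2, hL, hL2, hcase⟩
    rw [hL] at hL2
    rcases hcase with ⟨i, i2, hi2, hJ, hlt, hb⟩ | ⟨rfl, rfl⟩ | ⟨hJ, rfl⟩ |
      ⟨s, two, L22, O, base, w, htwo, hL22, hO, hbase, hw, hJ, hRb⟩
    · -- a binary digit of `n`
      have hJi : tval J / 2 = tval i := by rcases hJ with rfl | hJ <;> omega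
      have hJlt : tval J < 2 * Nat.size n := by omega
      have hi : tval i + 1 ≤ Nat.size n := by omega
      rw [bitN_iff hW hK1 hn i (lt_of_le_of_lt (Nat.pow_le_pow_right (by norm_num) hi) hsz)] at hb
      rw [getElem?_codeOf_header R hJlt, hJi, hb]
    · rw [← hL2, ← two_mul]
      exact getElem?_codeOf_sep0 R
    · rw [hJ, ← hL2, ← two_mul]
      exact getElem?_codeOf_sep1 R
    · -- a table bit
      rw [isVal_iff hW hK1 (hoff s), eval_offE_eq_tableOffset] at hO
      have hwval : tval w = (finFunctionFinEquiv (w ∘ Fin.castLE (hK s)) : ℕ) :=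
        tval_eq_of_high_zero (hK s) w hw
      have hpos : tval J = 2 * Nat.size n + 2 +
          ((finSigmaFinEquiv ⟨s, finFunctionFinEquiv (w ∘ Fin.castLE (hK s))⟩ :
            Fin (tableBits ar n)) : ℕ) := by
        rw [val_finSigmaFinEquiv_table]; omega
      rw [hpos, getElem?_codeOf_table R (Fin.is_lt _), Fin.eta, relTablesEquiv_apply_table, hRb]
  · intro h
    have hJlen : tval J < 2 * Nat.size n + 2 + tableBits ar n := by
      by_contra hle
      rw [getElem?_codeOf_none R (not_lt.1 hle)] at h
      cases h
    have h2ℓ : 2 * Nat.size n < n ^ K := by omega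
    refine ⟨tupOf _ hℓK, tupOf _ h2ℓ, tval_tupOf _ _, by rw [tval_tupOf, tval_tupOf]; ring, ?_⟩
    rcases Nat.lt_or_ge (tval J) (2 * Nat.size n) with hlt | hge
    · -- a binary digit
      left
      have hi : tval J / 2 < n ^ K := by omega
      have hi2 : 2 * (tval J / 2) < n ^ K := by omega
      refine ⟨tupOf _ hi, tupOf _ hi2, by rw [tval_tupOf, tval_tupOf]; ring, ?_,
        by rw [tval_tupOf]; exact hlt, ?_⟩
      · rcases Nat.even_or_odd (tval J) with ⟨k, hk⟩ | ⟨k, hk⟩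
        · left; apply tval_injective; rw [tval_tupOf]; omega
        · right; rw [tval_tupOf]; omega
      · have hb : tval (tupOf (tval J / 2) hi : Fin K → Fin n) + 1 ≤ Nat.size n := by
          rw [tval_tupOf]; omega
        rw [bitN_iff hW hK1 hn _ (lt_of_le_of_lt (Nat.pow_le_pow_right (by norm_num) hb) hsz),
          tval_tupOf]
        rw [getElem?_codeOf_header R hlt] at h
        exact Option.some.inj h
    rcases Nat.lt_or_ge (tval J) (2 * Nat.size n + 2) with hlt2 | hge2
    · rcases Nat.lt_or_ge (tval J) (2 * Nat.size n + 1) with hlt1 | hge1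
      · -- separator `0`
        right; left
        have hJ : tval J = 2 * Nat.size n := by omega
        rw [hJ, getElem?_codeOf_sep0 R] at h
        exact ⟨tval_injective (by rw [tval_tupOf, hJ]), (Option.some.inj h).symm⟩
      · -- separator `1`
        right; right; left
        have hJ : tval J = 2 * Nat.size n + 1 := by omega
        rw [hJ, getElem?_codeOf_sep1 R] at h
        exact ⟨by rw [tval_tupOf, hJ], (Option.some.inj h).symm⟩
    · -- a table bit
      right; right; right
      have hm : tval J - (2 * Nat.size n + 2) < tableBits ar n := by omega
      obtain ⟨s, w', hsw⟩ := exists_table_decomp hm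
      have hval := congrArg Fin.val hsw
      rw [val_finSigmaFinEquiv_table] at hval
      simp only [] at hval
      have hm' : tval J = 2 * Nat.size n + 2 + (tval J - (2 * Nat.size n + 2)) := by omega
      rw [hm', getElem?_codeOf_table R hm, ← hsw, relTablesEquiv_apply_table] at h
      have h2 : 2 < n ^ K := by omega
      have hL22 : 2 * Nat.size n + 2 < n ^ K := by omega
      have hO : tableOffset ar n s < n ^ K := by omega
      have hbase : 2 * Nat.size n + 2 + tableOffset ar n s < n ^ K := by omega
      refine ⟨s, tupOf 2 h2, tupOf _ hL22, tupOf _ hO, tupOf _ hbase, padT hnpos w',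
        tval_tupOf _ _, by rw [tval_tupOf, tval_tupOf, tval_tupOf], ?_,
        by rw [tval_tupOf, tval_tupOf, tval_tupOf], fun i hi => padT_high hnpos w' i hi, ?_, ?_⟩
      · rw [isVal_iff hW hK1 (hoff s), eval_offE_eq_tableOffset, tval_tupOf]
      · rw [tval_tupOf, tval_eq_of_high_zero (hK s) _ fun i hi => padT_high hnpos w' i hi,
          padT_comp_castLE]
        omega
      · rw [padT_comp_castLE]
        exact Option.some.inj h

end Iota

/-! ### Definability of `ι` -/

namespace JQuery

variable {ar rest : List ℕ} {K : ℕ} {α : Type}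

/-- **`ι` is first-order**: the input-bit query on a variable tuple is definable.
[Libkin 2004, proof of Thm. 9.6, p. 172] [folklore] -/
theorem isDef_inputBitP (hK : ∀ s : Fin ar.length, ar.get s ≤ K) (J : Fin K → α) (b : Bool) :
    IsDef (fun _ (R : RelTables ar _) (W : RelTables (arithWit K rest) _) (v : α → _) =>
      InputBitP W R hK (v ∘ J) b) := by
  -- outer block: `L = inl inr`, `L2 = inr`
  let V : Type := (α ⊕ Fin K) ⊕ Fin K
  let JV : Fin K → V := fun i => Sum.inl (Sum.inl (J i))
  let LV : Fin K → V := fun i => Sum.inl (Sum.inr i)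
  let L2V : Fin K → V := fun i => Sum.inr i
  -- case 1: inner block `i = inl inr`, `i2 = inr` over `V`
  have h1 : IsDef (fun _ (_ : RelTables ar _) (W : RelTables (arithWit K rest) _) (v : V → _) =>
      ∃ i i2 : Fin K → _, PlusP W i i i2 ∧ ((v ∘ JV) = i2 ∨ SuccP W K i2 (v ∘ JV)) ∧
        LtN W (v ∘ JV) (v ∘ L2V) ∧ BitN W i b) := by
    let iW : Fin K → (V ⊕ Fin K) ⊕ Fin K := fun i => Sum.inl (Sum.inr i)
    let i2W : Fin K → (V ⊕ Fin K) ⊕ Fin K := fun i => Sum.inr i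
    have := (isDef_plusP (ar := ar) (K := K) (rest := rest) iW iW i2W).and
      ((((isDef_tupEq (ar := ar) (wit := arithWit K rest) (Sum.inl ∘ Sum.inl ∘ JV) i2W).or
        (isDef_succP K i2W (Sum.inl ∘ Sum.inl ∘ JV))).and
        ((isDef_ltN (Sum.inl ∘ Sum.inl ∘ JV) (Sum.inl ∘ Sum.inl ∘ L2V)).and (isDef_bitN iW b))))
    exact (this.exs.exs).of_iff fun _ _ _ _ => Iff.rfl
  -- case 2, case 3
  have h2 : IsDef (fun _ (_ : RelTables ar _) (W : RelTables (arithWit K rest) _) (v : V → _) =>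
      (v ∘ JV) = (v ∘ L2V) ∧ b = false) :=
    (isDef_tupEq JV L2V).and (isDef_const _)
  have h3 : IsDef (fun _ (_ : RelTables ar _) (W : RelTables (arithWit K rest) _) (v : V → _) =>
      SuccP W K (v ∘ L2V) (v ∘ JV) ∧ b = true) :=
    (isDef_succP K L2V JV).and (isDef_const _)
  -- case 4: for each `s`, one block of five tuples `two L22 O base w ↦ 0 … 4`
  have h4 : ∀ s : Fin ar.length, IsDef (fun _ (R : RelTables ar _)
      (W : RelTables (arithWit K rest) _) (v : V → _) =>
      ∃ two L22 O base w : Fin K → _, IsConstN W 2 two ∧ PlusP W (v ∘ L2V) two L22 ∧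
        IsVal W (NExpr.offE ar s) O ∧ PlusP W L22 O base ∧
        (∀ i : Fin K, ar.get s ≤ (i : ℕ) → IsMinP W (w i)) ∧ PlusP W base w (v ∘ JV) ∧
        R s (w ∘ Fin.castLE (hK s)) = b) := by
    intro s
    let U : Type := V ⊕ (Fin 5 × Fin K)
    let t : Fin 5 → Fin K → U := fun j i => Sum.inr (j, i)
    have h : IsDef (fun _ (R : RelTables ar _) (W : RelTables (arithWit K rest) _) (v : U → _) =>
        IsConstN W 2 (v ∘ t 0) ∧ PlusP W (v ∘ Sum.inl ∘ L2V) (v ∘ t 0) (v ∘ t 1) ∧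
          IsVal W (NExpr.offE ar s) (v ∘ t 2) ∧ PlusP W (v ∘ t 1) (v ∘ t 2) (v ∘ t 3) ∧
          (∀ i : Fin K, ar.get s ≤ (i : ℕ) → IsMinP W (v (t 4 i))) ∧
          PlusP W (v ∘ t 3) (v ∘ t 4) (v ∘ Sum.inl ∘ JV) ∧
          R s (v ∘ t 4 ∘ Fin.castLE (hK s)) = b) :=
      (isDef_isConstN 2 (t 0)).and ((isDef_plusP (Sum.inl ∘ L2V) (t 0) (t 1)).and
        ((isDef_isVal (NExpr.offE ar s) (t 2)).and ((isDef_plusP (t 1) (t 2) (t 3)).and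
          ((IsDef.iInf fun i : Fin K => (isDef_const (ar.get s ≤ (i : ℕ))).imp
            (isDef_isMinP (t 4 i))).and
            ((isDef_plusP (t 3) (t 4) (Sum.inl ∘ JV)).and
              (isDef_inRel_eq s (t 4 ∘ Fin.castLE (hK s)) b))))))
    refine h.exs.of_iff fun _ _ W v => ?_
    constructor
    · rintro ⟨w, hw⟩
      exact ⟨_, _, _, _, _, hw⟩
    · rintro ⟨two, L22, O, base, w, hw⟩
      exact ⟨fun p => (![two, L22, O, base, w] : Fin 5 → Fin K → _) p.1 p.2, hw⟩
  have hmain := ((isDef_isVal (ar := ar) (K := K) (rest := rest) NExpr.size LV).and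
    ((isDef_plusP LV LV L2V).and (h1.or (h2.or (h3.or (IsDef.iSup h4)))))).exs.exs
  exact hmain.of_iff fun _ _ _ _ => Iff.rfl

end JQuery

end Literature.ModelTheory.FiniteModelTheory
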